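import Summits.QuantumFields.BalabanUV.T4Continuum.Support.B13StepOfRecordSub
import Summits.QuantumFields.BalabanUV.T4Continuum.Support.OutputRateTermwiseLoc

/-!
# NE5 ∕ U3 — the termwise END FACE E1 RE-POINTED TO THE R20 CARRIER: the assembled step model OVER AN ARBITRARY OPERATOR
# CARRIER `Op` (`B13RepresentsOn.AssemblyOn.stepOn`), the carriers OF RECORD over `Op` (`B13StepOfRecordSub.stepOn`), and the
# record's SUB-SLOT `M ≤ OpDatum E` (`onSub` ∕ `restrict`, of record `↥measOp`) — every IDENTIFICATION leaf (L01∕L02 MI-R, L03 base,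
# L08r structure, d3 `TermRep`) DISCHARGED by construction, W1 read ALONG THE READING, conclusion literally `T4OutputRate.NE5 …`
# (owner RULING R20, `CLAIMS.log` l.11032 «→ leaf-09 lineage»; carrier modules by leaf-03-g6, l.11871 «followers revert to leaf-09»;
# typer `t4/formal/NE5/DAG.md` END face E1[B13] = `B13StepEnd.ne5_of_assembly`, this lineage's)

Cell `pub-balaban`, unit `b2b-balaban-t4-ne5-formalise-leaf-09` (NE5 formalisation swarm, LEAF PROVER 09, gen 2; row O1-e holder:
`B13Represents` p208313∕p208605, `B13StepEnd` p208726, `B13StepOfRecord` p208933).  Summits-side new work under the LEAN PLACEMENT RULE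
(cell bookkeeping; NOT a Literature module; NO landed module is edited — this is a NEW module applying landed END faces BY NAME).
HONEST FRAMING: rung (B)+1 of the FINITE-VOLUME T⁴ continuum programme — NOT infinite volume, NOT a mass gap, NOT the Clay problem, and
**NOT A PROOF OF NE5** (NOT PRINTED in [Balaban1987RG1]–[Balaban1989LargeFieldII], which print ε-UNIFORM bounds, never η-RATES; cell
GAPS G-t4-U3-1): every theorem below is an IMPLICATION whose wall binders (W2 = the termwise majorant ∕ budget ∕ line analyticity of
the (2.14)-terms on the class — NOT PRINTED as stated; W1 in row NE2's entry currency or in margin units — NOT PRINTED; W4; the one-run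
slice budgets — W3-KIND; the one-run levels L05∕L06 — quoted SHAPES of [Balaban1987RG1] (1.18) p. 263; reach ∕ first scales ∕ smallness)
are DISPLAYED HYPOTHESES, asserted nowhere.  HONEST DEPENDENCY (cell line, verbatim): continuum YM on T⁴ ⇐ BetaPertH ∧ nine spine
estimates (0/9 proved); BetaPertH ⇐ (D1) ∧ (D4) ∧ CAP+tail; G-an2-4 gates asym, D1 and NE2/3/4.

WHY (R20).  Every operator-ball binder over `Op := OpDatum E = ℓ^∞(Species)` with `x`-indexed potential species is unsatisfiable
(G-ne5p2-5); the P1 step model of record was therefore RE-INSTANTIATED over a general operator carrier `Op` with a reading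
`rd : Op →L[ℂ] OpDatum E` (leaf-03-g6's `B13RepresentsOn` ∕ `B13StepOfRecordSub`; of record `Op := ↥measOp`, `rd := subtypeL`).  The END
faces are polymorphic in `Op`; what this file supplies is the APPLICATION of E1 on the new carrier with the identifications discharged,
so that the DISPLAYED census of E1 is available verbatim for cores typed on `↥M` (where leaf-08's (2.14) dictionary instance lives).

WHAT THIS FILE DOES (compositions BY NAME; no estimate of its own; 0 def).  CURRENCY: the owner's ruling R21 — termwise majorant
and budget PER DOMAIN (`OutputRateTermwiseLoc.TermBoundLoc κ a` ∕ `TermBudgetLoc a G`, `a k i X`; with absolute term labels the X-blind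
`TermBudget` of E1[B13] is volume-extensive, so no X-blind budget is left in any binder list below — owner R27 (ii)).
* §1 `termRep_stepOn_of_termBoundLoc` — d3-ii WITH PER-DOMAIN WEIGHTS: the output IS the series of its terms (`AssemblyOn.outIsSeries`,
  `rfl`), so `TermBoundLoc K (term …) W κ a` + summability of `a k · X` at every step-`k` domain give `TermRep (𝔄.stepOn BHist) K (term …) W`
  by leaf-04's X-dependent comparison test `TermRepOfSeries.termRep_of_outIsSeriesOn_boundAt` (p207933).
* §2 `ne5_of_assemblyOn_loc_opRate` — `OutputRateTermwiseLoc.ne5_at_of_stepModel_termwiseLoc_slack_scale_nat` (p215352) applied to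
  `𝔄.stepOn (𝔄.bHist E₀ cB)` for `𝔄 : AssemblyOn C Op IOp Hist ι P J` on the class `ballClass (selfCtr raw histRef) ROp RHist`: `hrA`∕`hrB` :=
  `representsA hT`∕`representsB`, `hbase` := `inBase`, `hbox` := `boxInClass` (room), `hrep` := §1, structure binders and `InsScaleBound` by
  construction — i.e. `B13StepEnd.ne5_of_assembly_opRate` with `Assembly ↦ AssemblyOn` and `TermBound`∕`TermBudget ↦ TermBoundLoc`∕
  `TermBudgetLoc`; `ne5_of_assemblyOn_loc_reading` — the same with W1 PRODUCED from row NE2's weighted entrywise two-run rate ALONG A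
  READING `rd` (`AssemblyOn.operatorRate_of_reading`: `‖z‖ ≤ ‖rd z‖`, `rd ∘ opA = opOf F rawA`, `rd ∘ opB = opOf F rawB`) — the twin of
  `B13StepEnd.ne5_of_assembly` (the case `rd := id`).
* §3 `ne5_of_recordOn_loc_opRate` — §2 on Bałaban's paired-torus carriers OF RECORD over `Op` (`B13StepOfRecordSub.stepOn S E₀ cB`,
  indexing `labelsIndexing …` ∕ hard core `touchInc …` OF RECORD, absolute labels `TermIdx`), a one-line specialisation; binder order =
  `B13StepEndInsOp.ne5_of_record_insOp`'s where the shapes coincide (owner R27 (iii)).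
* §4 ON THE SUB-SLOT `M ≤ OpDatum E` holding the operator data of record (`B13StepOfRecordSub.onSub S₀ M hA hB act`, cores `act`
  typed on `↥M`): `ne5_of_record_onSub_loc_loc` — W1 PRODUCED from the record's entry currency (`operatorRate_onSub_of_weightedEntrywise`),
  the reading ∕ the two slice budgets ∕ W4 STATED ON THE MODEL OF RECORD `B13StepOfRecord.step S₀ E₀ cB` and transferred by the
  `…_onSub_iff` lemmas (`Iff.rfl`); `ne5_of_record_restrict_loc_loc` — cores := `S₀.act` through the inclusion: conclusion LITERALLY
  `NE5 (B13StepOfRecord.outA S₀ E₀ cB) (B13StepOfRecord.outB S₀ E₀ cB) W κ θ′ C₅` (`outA_restrict`∕`outB_restrict`, `rfl`; owner R27 (i)),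
  with the W2 data displayed on the SUB-SLOT class (directions in `M` only — R20's point).  The slot OF RECORD is `M := measOp …`
  (R20): spell it `onSub S₀ (measOp T κ ι Ω 𝒴) hA hB act` — `B13StepOfRecordSub.onMeasOp S₀ hA hB act` unfolds to it (`rfl`), but in
  the `onMeasOp` spelling `term (assemblyOn (onMeasOp …)).𝒯 (assemblyOn (onMeasOp …)).inc act` exhausts the default heartbeats at
  `isDefEq` (observed on the farm while writing this file; INFO to the carrier module's author, no statement affected).
After this file the displayed census of E1 on the R20 carrier reads: the reading `TransportReads`; the two ONE-RUN slice budgets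
(W3-KIND); the levels `DecayBound outA∕outB` (L05∕L06 SHAPES); W1 (entry currency of record + margin floor, or `OperatorRate`); W4;
the termwise W2 data `TermBoundLoc`∕`TermBudgetLoc`∕`TermLineAnalytic` on the roomy sub-slot class (wall O2 — for (2.14)-shaped cores
the sibling `B13StepEndLoc` PRODUCES `TermBoundLoc` and the line analyticity from the ONE shape `TermGaussianParamBi` + mass letters);
room; numerics.  0 sorry; no new axioms.
-/

noncomputable section

open Metric Set

namespace Summit.QuantumFields.BalabanUV.T4Continuum.B13StepEndOn

open Literature.MathematicalPhysics.QuantumFieldTheory.Balaban1983to89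
open Literature.MathematicalPhysics.QuantumFieldTheory.Balaban1983to89.T4OutputRate (Carriers Functional DecayBound NE5)
open Literature.MathematicalPhysics.QuantumFieldTheory.Balaban1983to89.T4InputCauchyRateData (StepModel)
open Literature.MathematicalPhysics.QuantumFieldTheory.Balaban1983to89.T4InputCauchyRateSpecies (ballClass)
open Literature.MathematicalPhysics.QuantumFieldTheory.Balaban1983to89.T4InputCauchyRateTermwise (TermRep TermLineAnalytic)
open Summit.QuantumFields.BalabanUV.T4Continuum.B13Carriers (TwoRuns)
open Summit.QuantumFields.BalabanUV.T4Continuum.B13OpDatum (Format OpDatum)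
open Summit.QuantumFields.BalabanUV.T4Continuum.B13OpDatumJunctions (opOf RawBounded WeightedEntrywiseRate)
open Summit.QuantumFields.BalabanUV.T4Continuum.B13StepTermLabels (TermIdx InnerLabel)
open Summit.QuantumFields.BalabanUV.T4Continuum.B13StepTermFamily (term)
open Summit.QuantumFields.BalabanUV.T4Continuum.B13StepTermSocket (labelsIndexing touchInc)
open Summit.QuantumFields.BalabanUV.T4Continuum.B13InnerData (Bnd b13InnerData)
open Summit.QuantumFields.BalabanUV.T4Continuum.B13Base (selfCtr)
open Summit.QuantumFields.BalabanUV.T4Continuum.B13RepresentsOn (AssemblyOn)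
open Summit.QuantumFields.BalabanUV.T4Continuum.B13StepOfRecord (Slots assembly step)
open Summit.QuantumFields.BalabanUV.T4Continuum.B13StepOfRecordSub
  (SlotsOn assemblyOn stepOn outA outB onSub restrict transportReads_onSub_iff sliceBudgetB_onSub_iff
    sliceBudget_onSub_iff insertionRate_onSub_iff operatorRate_onSub_of_weightedEntrywise outA_restrict outB_restrict)
open Summit.QuantumFields.BalabanUV.T4Continuum.TermRepOfSeries (outIsSeriesOn_of_outIsSeries termRep_of_outIsSeriesOn_boundAt)
open Summit.QuantumFields.BalabanUV.T4Continuum.OutputRateTermwiseLoc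
  (TermBoundLoc TermBudgetLoc ne5_at_of_stepModel_termwiseLoc_slack_scale_nat)

/-! ## §1 d3-ii with PER-DOMAIN weights: `TermRep` for the assembled model over `Op` from a localized majorant -/

section TermRepLoc

variable {C : Carriers} {Op IOp Hist ι P J : Type*} [NormedAddCommGroup Op] [NormedSpace ℂ Op] [NormedAddCommGroup Hist]
  [NormedSpace ℂ Hist] {𝔄 : AssemblyOn C Op IOp Hist ι P J} {BHist : ℕ → ℝ}

/-- [folklore] **`TermRep` FOR THE ASSEMBLED MODEL OVER `Op` FROM A PER-DOMAIN TERMWISE MAJORANT** (ruling R21's currency): the output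
IS the series of its terms (`AssemblyOn.outIsSeries`, `rfl`), so `TermBoundLoc K (term …) W κ a` and summability of the weights `a k · X`
at every step-`k` domain give `TermRep (𝔄.stepOn BHist) K (term …) W` by leaf-04's X-dependent comparison test
(`TermRepOfSeries.termRep_of_outIsSeriesOn_boundAt`; the two files index the weight as `a k X i` ∕ `a k i X` — a re-indexing).  Printed
SUPPORT for the per-domain form: [Balaban1988RG2Cluster] (2.41) p. 21 bounds `|𝐄^{(k+1)}(X)|` FOR EACH `X` (locator only; nothing asserted
about Bałaban's terms). -/
theorem termRep_stepOn_of_termBoundLoc {K : ℕ → (ℕ → ℝ) → C.BgB → Set (Op × Hist)} {W : Set (ℕ → ℝ)} {κ : ℝ}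
    {a : ℕ → ι → C.Dom → ℝ} (hbd : TermBoundLoc K (term 𝔄.𝒯 𝔄.inc 𝔄.act) W κ a)
    (ha : ∀ (k : ℕ) (X : C.Dom), C.scale X = k → Summable fun i => a k i X) :
    TermRep (𝔄.stepOn BHist) K (term 𝔄.𝒯 𝔄.inc 𝔄.act) W :=
  termRep_of_outIsSeriesOn_boundAt (a := fun k X i => a k i X) (outIsSeriesOn_of_outIsSeries AssemblyOn.outIsSeries K W)
    (fun k g hg U q hq X hX i => hbd k g hg U q hq X hX i) fun k X hX => ha k X hX

end TermRepLoc

/-! ## §2 E1 on the assembled step model over an arbitrary operator carrier `Op` (per-domain currency) -/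

section OverOp

variable {C : Carriers} {Op IOp Hist ι P J : Type*} [NormedAddCommGroup Op] [NormedSpace ℂ Op] [NormedAddCommGroup Hist]
  [NormedSpace ℂ Hist] (𝔄 : AssemblyOn C Op IOp Hist ι P J)

/-- [folklore] **THE TERMWISE END FACE ON THE ASSEMBLED STEP MODEL OVER `Op`, W1 IN MARGIN UNITS.**  For `𝔄.stepOn (𝔄.bHist E₀ cB)`
with its recursively defined outputs `outA`∕`outB`: the transport READING, the DISPLAYED one-run slice budgets of both runs (W3-KIND;
B-side for the base, A-side for the feedback gain `cA`), the quoted one-run levels `DecayBound outA W EA₀ κ` ∕ `DecayBound outB W E₀ κ`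
(L05∕L06 SHAPES), the DISPLAYED `OperatorRate δ θ` (W1, margin units) and `InsertionRate δ′` (W4), the DISPLAYED termwise data of the
(2.14)-terms on the roomy class `ballClass (selfCtr raw histRef) ROp RHist` IN THE PER-DOMAIN CURRENCY — `TermBoundLoc κ a`,
`TermBudgetLoc a G`, `TermLineAnalytic` (W2, wall O2; a family of subsets of `Op × Hist`) —, the two room inequalities and the numerics
IMPLY `NE5 outA outB W κ θ′ C₅` with the termwise END faces' constant.  MI-R, L03, the slack `BoxInClass` (room), the structure binders
and `TermRep` (§1) are DISCHARGED inside (`B13RepresentsOn` by name); the face applied is the owner's `OutputRateTermwiseLoc.ne5_at_of_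
stepModel_termwiseLoc_slack_scale_nat`.  = `B13StepEnd.ne5_of_assembly_opRate` with `Assembly ↦ AssemblyOn` and the budget localized.
NOT a proof of NE5: an implication from displayed binders. -/
theorem ne5_of_assemblyOn_loc_opRate {W : Set (ℕ → ℝ)} {ROp RHist : ℕ → ℝ} {a : ℕ → ι → C.Dom → ℝ}
    {κ G EA₀ E₀ E₁ cA cB δ δ' θ θ' ρ₀ B : ℝ} {k₀ : ℕ}
    (hT : 𝔄.TransportReads W)
    (hbB : 𝔄.SliceBudgetB W κ cB) (hbA : 𝔄.D.SliceBudget (𝔄.stepOn (𝔄.bHist E₀ cB)) W κ cA)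
    (hdA : DecayBound (𝔄.outA (𝔄.bHist E₀ cB)) W EA₀ κ) (hdB : DecayBound (𝔄.outB (𝔄.bHist E₀ cB)) W E₀ κ)
    (hop : (𝔄.stepOn (𝔄.bHist E₀ cB)).OperatorRate W δ θ) (hins : (𝔄.stepOn (𝔄.bHist E₀ cB)).InsertionRate W κ E₀ δ' θ)
    (hbd : TermBoundLoc (ballClass (selfCtr 𝔄.raw 𝔄.histRef) ROp RHist) (term 𝔄.𝒯 𝔄.inc 𝔄.act) W κ a)
    (hbud : TermBudgetLoc a G) (hline : TermLineAnalytic (ballClass (selfCtr 𝔄.raw 𝔄.histRef) ROp RHist) (term 𝔄.𝒯 𝔄.inc 𝔄.act) W)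
    (hOp : ∀ k, 𝔄.rOp k ≤ ROp k) (hHist : ∀ k, 𝔄.bHist E₀ cB k + 𝔄.rHist k ≤ RHist k)
    (hE₀ : 0 ≤ E₀) (hE₁ : 0 < E₁) (hG : 0 ≤ G) (hcA : 0 ≤ cA) (hcB : 0 ≤ cB) (hδ : 0 ≤ δ) (hδ' : 0 ≤ δ')
    (hθ : 0 ≤ θ) (hθθ' : θ ≤ θ') (hθ'1 : θ' ≤ 1) (hω : 0 < 𝔄.D.ω) (hω1 : 𝔄.D.ω < 1) (hρ₀ : ρ₀ < 1)
    (hnear : (δ + δ') * θ ^ k₀ + cA * (EA₀ + E₀) / (1 - 𝔄.D.ω) ≤ ρ₀) (hB : 0 ≤ B)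
    (hfirst : ∀ k < k₀, EA₀ + E₀ ≤ B * θ ^ k) (hsmall : 𝔄.D.ω + G / (1 - ρ₀) * cA < θ') :
    NE5 (𝔄.outA (𝔄.bHist E₀ cB)) (𝔄.outB (𝔄.bHist E₀ cB)) W κ θ'
      ((G / (1 - ρ₀) * δ + G / (1 - ρ₀) * δ' + B) * (θ' - 𝔄.D.ω) / (θ' - (𝔄.D.ω + G / (1 - ρ₀) * cA))) :=
  ne5_at_of_stepModel_termwiseLoc_slack_scale_nat (𝔄.stepOn (𝔄.bHist E₀ cB)) (ballClass (selfCtr 𝔄.raw 𝔄.histRef) ROp RHist)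
    (term 𝔄.𝒯 𝔄.inc 𝔄.act) (𝔄.representsA _ hT) (𝔄.representsB _ W) (AssemblyOn.inBase hbB hdB hE₀ hcB hω.le hω1)
    (𝔄.boxInClass _ W hOp hHist) (termRep_stepOn_of_termBoundLoc hbd fun k X hX => (hbud k X hX).1) hbd hbud hline hdA hdB hop
    hins (𝔄.insAffine _ W) (𝔄.insBlind _ W) (𝔄.insHomog _ W) (AssemblyOn.insScaleBound hbA hω.le hE₁.le) hE₁ hG hδ hδ' hθ hθθ'
    hθ'1 hcA hω hρ₀ hnear hB hfirst hsmall

/-- [folklore] **THE TERMWISE END FACE ON THE ASSEMBLED STEP MODEL OVER `Op`, W1 FROM ROW NE2's ENTRY CURRENCY ALONG A READING**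
(R20: «W1's raw-species rates∕readings transfer along `rd` verbatim»).  As `ne5_of_assemblyOn_loc_opRate`, with `hop` PRODUCED by
`AssemblyOn.operatorRate_of_reading` from: a reading `rd : Op →L[ℂ] OpDatum E` that does not contract norms, under which the model's
operator data ARE row O1-b's `opOf F rawA` ∕ `opOf F rawB`; bounded raw suppliers on the window; row NE2's weighted entrywise two-run
species rate `c₁·θ^k` between run A's species AT THE TRANSPORTED BACKGROUND and run B's (DISPLAYED, NOT PRINTED); a margin floor
`r₀ ≤ rOp k` (`δ := c₁∕r₀`).  The twin of `B13StepEnd.ne5_of_assembly`, which is the case `Op := OpDatum E`, `rd := id`. -/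
theorem ne5_of_assemblyOn_loc_reading {E : Type*} (rd : Op →L[ℂ] OpDatum E) (hrd : ∀ z : Op, ‖z‖ ≤ ‖rd z‖)
    {F : ℕ → Format E} {rawA : (ℕ → ℝ) → C.BgA → ℕ → E → ℂ} {rawB : (ℕ → ℝ) → C.BgB → ℕ → E → ℂ}
    (hrdA : ∀ g V k, rd (𝔄.opA g V k) = opOf F rawA g V k) (hrdB : ∀ g U k, rd (𝔄.opB g U k) = opOf F rawB g U k)
    {W : Set (ℕ → ℝ)} {ROp RHist : ℕ → ℝ} {a : ℕ → ι → C.Dom → ℝ}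
    {κ G EA₀ E₀ E₁ cA cB c₁ r₀ δ' θ θ' ρ₀ B : ℝ} {k₀ : ℕ}
    (hT : 𝔄.TransportReads W)
    (hbB : 𝔄.SliceBudgetB W κ cB) (hbA : 𝔄.D.SliceBudget (𝔄.stepOn (𝔄.bHist E₀ cB)) W κ cA)
    (hdA : DecayBound (𝔄.outA (𝔄.bHist E₀ cB)) W EA₀ κ) (hdB : DecayBound (𝔄.outB (𝔄.bHist E₀ cB)) W E₀ κ)
    (hRA : RawBounded F (fun g U k => rawA g (C.transport U) k) W) (hRB : RawBounded F rawB W)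
    (hwer : WeightedEntrywiseRate F (fun g U k => rawA g (C.transport U) k) rawB W c₁ fun k => θ ^ k)
    (hfl : ∀ k, r₀ ≤ 𝔄.rOp k) (hins : (𝔄.stepOn (𝔄.bHist E₀ cB)).InsertionRate W κ E₀ δ' θ)
    (hbd : TermBoundLoc (ballClass (selfCtr 𝔄.raw 𝔄.histRef) ROp RHist) (term 𝔄.𝒯 𝔄.inc 𝔄.act) W κ a)
    (hbud : TermBudgetLoc a G) (hline : TermLineAnalytic (ballClass (selfCtr 𝔄.raw 𝔄.histRef) ROp RHist) (term 𝔄.𝒯 𝔄.inc 𝔄.act) W)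
    (hOp : ∀ k, 𝔄.rOp k ≤ ROp k) (hHist : ∀ k, 𝔄.bHist E₀ cB k + 𝔄.rHist k ≤ RHist k)
    (hE₀ : 0 ≤ E₀) (hE₁ : 0 < E₁) (hG : 0 ≤ G) (hcA : 0 ≤ cA) (hcB : 0 ≤ cB) (hc₁ : 0 ≤ c₁) (hr₀ : 0 < r₀) (hδ' : 0 ≤ δ')
    (hθ : 0 ≤ θ) (hθθ' : θ ≤ θ') (hθ'1 : θ' ≤ 1) (hω : 0 < 𝔄.D.ω) (hω1 : 𝔄.D.ω < 1) (hρ₀ : ρ₀ < 1)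
    (hnear : (c₁ / r₀ + δ') * θ ^ k₀ + cA * (EA₀ + E₀) / (1 - 𝔄.D.ω) ≤ ρ₀) (hB : 0 ≤ B)
    (hfirst : ∀ k < k₀, EA₀ + E₀ ≤ B * θ ^ k) (hsmall : 𝔄.D.ω + G / (1 - ρ₀) * cA < θ') :
    NE5 (𝔄.outA (𝔄.bHist E₀ cB)) (𝔄.outB (𝔄.bHist E₀ cB)) W κ θ'
      ((G / (1 - ρ₀) * (c₁ / r₀) + G / (1 - ρ₀) * δ' + B) * (θ' - 𝔄.D.ω) / (θ' - (𝔄.D.ω + G / (1 - ρ₀) * cA))) :=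
  ne5_of_assemblyOn_loc_opRate 𝔄 hT hbB hbA hdA hdB
    (AssemblyOn.operatorRate_of_reading rd hrd hrdA hrdB hRA hRB hwer hc₁ hθ hfl hr₀) hins hbd hbud hline hOp hHist hE₀ hE₁ hG
    hcA hcB (div_nonneg hc₁ hr₀.le) hδ' hθ hθθ' hθ'1 hω hω1 hρ₀ hnear hB hfirst hsmall

end OverOp

/-! ## §3 E1 on the carriers OF RECORD over `Op` -/

section RecordOn

variable {G : Type} [GaugeGroup G] {R : TwoRuns G} {Op IOp Hist : Type*} [NormedAddCommGroup Op] [NormedSpace ℂ Op]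
  [NormedAddCommGroup Hist] [NormedSpace ℂ Hist] (S : SlotsOn R Op IOp Hist) (E₀ cB : ℝ)

/-- [folklore] **THE TERMWISE END FACE ON THE CARRIERS OF RECORD OVER `Op`** (`B13StepOfRecordSub.stepOn S E₀ cB` on
`B13Carriers.TwoRuns.carriers R`, indexing ∕ hard core OF RECORD): conclusion LITERALLY `T4OutputRate.NE5 (outA S E₀ cB) (outB S E₀ cB)
W κ θ′ C₅`; W1 in margin units; every wall displayed; the analytic slots `S` are PARAMETERS (nothing of [Balaban1988RG2Cluster]'s kernels ∕
potentials ∕ (2.14)-terms is identified here). -/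
theorem ne5_of_recordOn_loc_opRate {W : Set (ℕ → ℝ)} {ROp RHist : ℕ → ℝ} {a : ℕ → TermIdx R.carriers.Dom (Bnd R) → R.carriers.Dom → ℝ}
    {κ G EA₀ E₁ cA δ δ' θ θ' ρ₀ B : ℝ} {k₀ : ℕ}
    (hT : (assemblyOn S).TransportReads W)
    (hbB : (assemblyOn S).SliceBudgetB W κ cB) (hbA : S.D.SliceBudget (stepOn S E₀ cB) W κ cA)
    (hdA : DecayBound (outA S E₀ cB) W EA₀ κ) (hdB : DecayBound (outB S E₀ cB) W E₀ κ)
    (hop : (stepOn S E₀ cB).OperatorRate W δ θ) (hins : (stepOn S E₀ cB).InsertionRate W κ E₀ δ' θ)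
    (hbd : TermBoundLoc (ballClass (selfCtr (assemblyOn S).raw (assemblyOn S).histRef) ROp RHist)
      (term (assemblyOn S).𝒯 (assemblyOn S).inc S.act) W κ a)
    (hbud : TermBudgetLoc a G)
    (hline : TermLineAnalytic (ballClass (selfCtr (assemblyOn S).raw (assemblyOn S).histRef) ROp RHist)
      (term (assemblyOn S).𝒯 (assemblyOn S).inc S.act) W)
    (hOp : ∀ k, S.rOp k ≤ ROp k) (hHist : ∀ k, (assemblyOn S).bHist E₀ cB k + S.rHist k ≤ RHist k)
    (hE₀ : 0 ≤ E₀) (hE₁ : 0 < E₁) (hG : 0 ≤ G) (hcA : 0 ≤ cA) (hcB : 0 ≤ cB) (hδ : 0 ≤ δ) (hδ' : 0 ≤ δ')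
    (hθ : 0 ≤ θ) (hθθ' : θ ≤ θ') (hθ'1 : θ' ≤ 1) (hω : 0 < S.D.ω) (hω1 : S.D.ω < 1) (hρ₀ : ρ₀ < 1)
    (hnear : (δ + δ') * θ ^ k₀ + cA * (EA₀ + E₀) / (1 - S.D.ω) ≤ ρ₀) (hB : 0 ≤ B)
    (hfirst : ∀ k < k₀, EA₀ + E₀ ≤ B * θ ^ k) (hsmall : S.D.ω + G / (1 - ρ₀) * cA < θ') :
    NE5 (outA S E₀ cB) (outB S E₀ cB) W κ θ'
      ((G / (1 - ρ₀) * δ + G / (1 - ρ₀) * δ' + B) * (θ' - S.D.ω) / (θ' - (S.D.ω + G / (1 - ρ₀) * cA))) :=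
  ne5_of_assemblyOn_loc_opRate (assemblyOn S) hT hbB hbA hdA hdB hop hins hbd hbud hline hOp hHist hE₀ hE₁ hG hcA hcB hδ hδ' hθ
    hθθ' hθ'1 hω hω1 hρ₀ hnear hB hfirst hsmall

end RecordOn

/-! ## §4 E1 on the SUB-SLOT `M ≤ OpDatum E` holding the operator data of record (of record `↥measOp`, R20) -/

section OnSub

variable {G : Type} [GaugeGroup G] {R : TwoRuns G} {E IOp Hist : Type*} [NormedAddCommGroup Hist] [NormedSpace ℂ Hist]
  (S₀ : Slots R E IOp Hist) (M : Submodule ℂ (OpDatum E))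
  (hMA : ∀ g V k, opOf S₀.F S₀.rawA g V k ∈ M) (hMB : ∀ g U k, opOf S₀.F S₀.rawB g U k ∈ M)
  (act : R.carriers.Dom → InnerLabel R.carriers.Dom (Bnd R) → M → Hist → ℂ) (E₀ cB : ℝ)

/-- [folklore] **THE TERMWISE END FACE ON THE SUB-SLOT, CORES TYPED ON `↥M`** (`B13StepOfRecordSub.stepOn (onSub S₀ M hMA hMB act)
E₀ cB : StepModel R.carriers ↥M Hist`).  DISPLAYED ON THE MODEL OF RECORD `B13StepOfRecord.step S₀ E₀ cB` (and transferred inside by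
`Iff.rfl`): the transport reading, the two one-run slice budgets, W4; W1 PRODUCED from the record's bounded raw suppliers + row NE2's
weighted entrywise two-run rate `c₁·θ^k` + the margin floor `r₀` (`operatorRate_onSub_of_weightedEntrywise`, reading `subtypeL`);
DISPLAYED ON THE SUB-SLOT MODEL: the levels of ITS outputs and the termwise W2 data of the cores `act` on the sub-slot class
`ballClass (selfCtr …) ROp RHist ⊆ ↥M × Hist` (directions IN `M` — R20); room; numerics.  Conclusion LITERALLY
`T4OutputRate.NE5 (outA (onSub S₀ M hMA hMB act) E₀ cB) (outB (onSub S₀ M hMA hMB act) E₀ cB) W κ θ′ C₅`. -/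
theorem ne5_of_record_onSub_loc {W : Set (ℕ → ℝ)} {ROp RHist : ℕ → ℝ} {a : ℕ → TermIdx R.carriers.Dom (Bnd R) → R.carriers.Dom → ℝ}
    {κ G EA₀ E₁ cA c₁ r₀ δ' θ θ' ρ₀ B : ℝ} {k₀ : ℕ}
    (hT : (assembly S₀).TransportReads W)
    (hbB : (assembly S₀).SliceBudgetB W κ cB) (hbA : S₀.D.SliceBudget (step S₀ E₀ cB) W κ cA)
    (hdA : DecayBound (outA (onSub S₀ M hMA hMB act) E₀ cB) W EA₀ κ)
    (hdB : DecayBound (outB (onSub S₀ M hMA hMB act) E₀ cB) W E₀ κ)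
    (hRA : RawBounded S₀.F (assembly S₀).rawAt W) (hRB : RawBounded S₀.F S₀.rawB W)
    (hwer : WeightedEntrywiseRate S₀.F (assembly S₀).rawAt S₀.rawB W c₁ fun k => θ ^ k) (hfl : ∀ k, r₀ ≤ S₀.rOp k)
    (hins : (step S₀ E₀ cB).InsertionRate W κ E₀ δ' θ)
    (hbd : TermBoundLoc (ballClass (selfCtr (assemblyOn (onSub S₀ M hMA hMB act)).raw (assemblyOn (onSub S₀ M hMA hMB act)).histRef)
      ROp RHist) (term (assemblyOn (onSub S₀ M hMA hMB act)).𝒯 (assemblyOn (onSub S₀ M hMA hMB act)).inc act) W κ a)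
    (hbud : TermBudgetLoc a G)
    (hline : TermLineAnalytic (ballClass (selfCtr (assemblyOn (onSub S₀ M hMA hMB act)).raw
      (assemblyOn (onSub S₀ M hMA hMB act)).histRef) ROp RHist)
      (term (assemblyOn (onSub S₀ M hMA hMB act)).𝒯 (assemblyOn (onSub S₀ M hMA hMB act)).inc act) W)
    (hOp : ∀ k, S₀.rOp k ≤ ROp k) (hHist : ∀ k, (assembly S₀).bHist E₀ cB k + S₀.rHist k ≤ RHist k)
    (hE₀ : 0 ≤ E₀) (hE₁ : 0 < E₁) (hG : 0 ≤ G) (hcA : 0 ≤ cA) (hcB : 0 ≤ cB) (hc₁ : 0 ≤ c₁) (hr₀ : 0 < r₀) (hδ' : 0 ≤ δ')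
    (hθ : 0 ≤ θ) (hθθ' : θ ≤ θ') (hθ'1 : θ' ≤ 1) (hω : 0 < S₀.D.ω) (hω1 : S₀.D.ω < 1) (hρ₀ : ρ₀ < 1)
    (hnear : (c₁ / r₀ + δ') * θ ^ k₀ + cA * (EA₀ + E₀) / (1 - S₀.D.ω) ≤ ρ₀) (hB : 0 ≤ B)
    (hfirst : ∀ k < k₀, EA₀ + E₀ ≤ B * θ ^ k) (hsmall : S₀.D.ω + G / (1 - ρ₀) * cA < θ') :
    NE5 (outA (onSub S₀ M hMA hMB act) E₀ cB) (outB (onSub S₀ M hMA hMB act) E₀ cB) W κ θ'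
      ((G / (1 - ρ₀) * (c₁ / r₀) + G / (1 - ρ₀) * δ' + B) * (θ' - S₀.D.ω) / (θ' - (S₀.D.ω + G / (1 - ρ₀) * cA))) :=
  ne5_of_recordOn_loc_opRate (onSub S₀ M hMA hMB act) E₀ cB ((transportReads_onSub_iff S₀ M hMA hMB act W).2 hT)
    ((sliceBudgetB_onSub_iff S₀ M hMA hMB act W κ cB).2 hbB) ((sliceBudget_onSub_iff S₀ M hMA hMB act E₀ cB W κ cA).2 hbA) hdA hdB
    (operatorRate_onSub_of_weightedEntrywise S₀ M hMA hMB act E₀ cB hRA hRB hwer hc₁ hθ hfl hr₀)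
    ((insertionRate_onSub_iff S₀ M hMA hMB act E₀ cB W κ E₀ δ' θ).2 hins) hbd hbud hline hOp hHist hE₀ hE₁ hG hcA hcB
    (div_nonneg hc₁ hr₀.le) hδ' hθ hθθ' hθ'1 hω hω1 hρ₀ hnear hB hfirst hsmall

/-- [folklore] **THE TERMWISE END FACE ON THE SUB-SLOT WITH THE CORES OF RECORD RESTRICTED TO `M`** (`B13StepOfRecordSub.restrict
S₀ M hMA hMB`: cores := `S₀.act` read through the inclusion `↥M → OpDatum E`).  Its outputs ARE the outputs of record
(`outA_restrict`∕`outB_restrict`, `rfl` — the recursion (2.13) reads `Out` only at the runs' own operator data, which lie in `M`), so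
the conclusion is LITERALLY `T4OutputRate.NE5 (B13StepOfRecord.outA S₀ E₀ cB) (B13StepOfRecord.outB S₀ E₀ cB) W κ θ′ C₅` — the shape
node U3's consumers read — while the W2 data are displayed on the SUB-SLOT class (complex operator directions IN `M` only: the form in
which they are satisfiable for `x`-indexed cores, R20 ∕ G-ne5p2-5).  Levels, reading, slice budgets, W4, W1's entry currency: all ON THE
MODEL OF RECORD. -/
theorem ne5_of_record_restrict_loc {W : Set (ℕ → ℝ)} {ROp RHist : ℕ → ℝ} {a : ℕ → TermIdx R.carriers.Dom (Bnd R) → R.carriers.Dom → ℝ}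
    {κ G EA₀ E₁ cA c₁ r₀ δ' θ θ' ρ₀ B : ℝ} {k₀ : ℕ}
    (hT : (assembly S₀).TransportReads W)
    (hbB : (assembly S₀).SliceBudgetB W κ cB) (hbA : S₀.D.SliceBudget (step S₀ E₀ cB) W κ cA)
    (hdA : DecayBound (B13StepOfRecord.outA S₀ E₀ cB) W EA₀ κ) (hdB : DecayBound (B13StepOfRecord.outB S₀ E₀ cB) W E₀ κ)
    (hRA : RawBounded S₀.F (assembly S₀).rawAt W) (hRB : RawBounded S₀.F S₀.rawB W)
    (hwer : WeightedEntrywiseRate S₀.F (assembly S₀).rawAt S₀.rawB W c₁ fun k => θ ^ k) (hfl : ∀ k, r₀ ≤ S₀.rOp k)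
    (hins : (step S₀ E₀ cB).InsertionRate W κ E₀ δ' θ)
    (hbd : TermBoundLoc (ballClass (selfCtr (assemblyOn (restrict S₀ M hMA hMB)).raw (assemblyOn (restrict S₀ M hMA hMB)).histRef)
      ROp RHist) (term (assemblyOn (restrict S₀ M hMA hMB)).𝒯 (assemblyOn (restrict S₀ M hMA hMB)).inc (restrict S₀ M hMA hMB).act) W κ a)
    (hbud : TermBudgetLoc a G)
    (hline : TermLineAnalytic (ballClass (selfCtr (assemblyOn (restrict S₀ M hMA hMB)).raw
      (assemblyOn (restrict S₀ M hMA hMB)).histRef) ROp RHist)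
      (term (assemblyOn (restrict S₀ M hMA hMB)).𝒯 (assemblyOn (restrict S₀ M hMA hMB)).inc (restrict S₀ M hMA hMB).act) W)
    (hOp : ∀ k, S₀.rOp k ≤ ROp k) (hHist : ∀ k, (assembly S₀).bHist E₀ cB k + S₀.rHist k ≤ RHist k)
    (hE₀ : 0 ≤ E₀) (hE₁ : 0 < E₁) (hG : 0 ≤ G) (hcA : 0 ≤ cA) (hcB : 0 ≤ cB) (hc₁ : 0 ≤ c₁) (hr₀ : 0 < r₀) (hδ' : 0 ≤ δ')
    (hθ : 0 ≤ θ) (hθθ' : θ ≤ θ') (hθ'1 : θ' ≤ 1) (hω : 0 < S₀.D.ω) (hω1 : S₀.D.ω < 1) (hρ₀ : ρ₀ < 1)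
    (hnear : (c₁ / r₀ + δ') * θ ^ k₀ + cA * (EA₀ + E₀) / (1 - S₀.D.ω) ≤ ρ₀) (hB : 0 ≤ B)
    (hfirst : ∀ k < k₀, EA₀ + E₀ ≤ B * θ ^ k) (hsmall : S₀.D.ω + G / (1 - ρ₀) * cA < θ') :
    NE5 (B13StepOfRecord.outA S₀ E₀ cB) (B13StepOfRecord.outB S₀ E₀ cB) W κ θ'
      ((G / (1 - ρ₀) * (c₁ / r₀) + G / (1 - ρ₀) * δ' + B) * (θ' - S₀.D.ω) / (θ' - (S₀.D.ω + G / (1 - ρ₀) * cA))) := by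
  have hdA' : DecayBound (outA (restrict S₀ M hMA hMB) E₀ cB) W EA₀ κ := by rwa [outA_restrict]
  have hdB' : DecayBound (outB (restrict S₀ M hMA hMB) E₀ cB) W E₀ κ := by rwa [outB_restrict]
  have h := ne5_of_record_onSub_loc S₀ M hMA hMB _ E₀ cB hT hbB hbA hdA' hdB' hRA hRB hwer hfl hins hbd hbud hline hOp hHist hE₀ hE₁
    hG hcA hcB hc₁ hr₀ hδ' hθ hθθ' hθ'1 hω hω1 hρ₀ hnear hB hfirst hsmall
  rw [← outA_restrict S₀ M hMA hMB E₀ cB, ← outB_restrict S₀ M hMA hMB E₀ cB]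
  exact h

end OnSub

end Summit.QuantumFields.BalabanUV.T4Continuum.B13StepEndOn

end
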